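import Literature.NumberTheory.EllipticCurves.CompactSelmerTowerNormProofs
import Mathlib.RingTheory.Filtration
import HarnessLib

/-!
# The `ℤ_p`-span of a finite family in `∏_m H¹(H, E[p^m])`, the KRULL STEP `⋂_n (M + pⁿ R) = M` for a
# finitely generated residual module `R`, and an abstract TRANSPORT predicate along norm / restriction maps
# (bookkeeping for the universal-norm argument of the Heegner-module envelope; proofs file)

Topic `NumberTheory/EllipticCurves`. THEOREMS ONLY (no definition, no named fact, no `sorry`); sequel of
`CompactSelmerTowerNormProofs`. Written by the cell `bsd-print-x9` seat `bsd-line-x9-p2` for the stub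
`stub_envelopeTied` of crux stmt-BirchSwinnertonDyer-26359 `PrintX9.HowardContainmentLightFramePinnedOfPrint`
(consumed by `HeegnerEnvelopeUniversalNormProofs`).

WHAT.
* §1 `exists_addMonoidHom_padicPi_sum` — the `ℤ_p`-span map `f ↦ Σ_b f_b · r_b` of a finite family
  `r : B → ∏_m H¹(H, E[p^m])` as an additive map `(B → ℤ_p) →+ ∏ H¹` compatible with the `ℤ_p`-action
  (existence form, no definition); `mem_of_forall_eq_add_sum_padicPi_pow_mul` — KRULL STEP: if a subgroup `M`
  is `ℤ_p`-stable and `x = m_n + Σ_b pⁿ f_{n,b} · r_b` with `m_n ∈ M` for EVERY `n`, then `x ∈ M` (Krull's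
  intersection theorem for the finitely generated `ℤ_p`-module `ℤ_p^B / Φ⁻¹(M)`, Mathlib
  `Ideal.iInf_pow_smul_eq_bot_of_isLocalRing`).
* §2 the transport predicate `∃ m ∈ M, ∃ f, 𝒩 x = res (m + Ψ (q • f))` for additive maps `𝒩 : V₁ → V₁`,
  `res : V₀ → V₁`, `Ψ : P → V₀`: stable under the subgroup operations (`exists_norm_eq_res_of_mem_closure`),
  under compatible operator pairs (`exists_norm_eq_res_map`), integer multiples and sums.
HONEST FRAMING: abstract module bookkeeping; nothing about any particular curve; BSD is not proved by any of this.

References: [PerrinRiou1987BSMF] §0 pp. 401–402 (`S_p(L)` compact `ℤ_p`-modules, norm-compatible families);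
[Washington1997] §13.2 (compact modules over `ℤ_p` and `Λ`); Krull's intersection theorem.
-/

set_option autoImplicit false

noncomputable section

open scoped Classical

open WeierstrassCurve Literature.NumberTheory.EllipticCurves PowerSeries

universe u

/-! ## §1 The `ℤ_p`-span of a finite family and the Krull step -/

namespace WeierstrassCurve

section Krull

variable {K : Type u} [Field K] (V : WeierstrassCurve K) (p : ℕ) [Fact p.Prime]
  (H : Subgroup (Field.absoluteGaloisGroup K))

/-- **The `ℤ_p`-span map of a finite family** `r : B → ∏_m H¹(H, E[p^m])`: an additive map
`Φ : (B → ℤ_p) → ∏_m H¹(H, E[p^m])`, `Φ f = Σ_b f_b · r_b`, with `Φ (c • f) = c · Φ f` (existence, so that no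
definition is introduced). [cite: PerrinRiou1987BSMF, §0 p. 401 (S_p(L) as a compact ℤ_p-module)] -/
theorem exists_addMonoidHom_padicPi_sum {B : Type*} [Fintype B] (r : B → V.torsionH1Pi p H) :
    ∃ Φ : (B → ℤ_[p]) →+ V.torsionH1Pi p H,
      (∀ f, Φ f = ∑ b, V.padicPi p H (f b) (r b)) ∧ ∀ (c : ℤ_[p]) f, Φ (c • f) = V.padicPi p H c (Φ f) := by
  refine ⟨{ toFun := fun f ↦ ∑ b, V.padicPi p H (f b) (r b)
            map_zero' := by simp only [Pi.zero_apply, padicPi_zero_left, Finset.sum_const_zero]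
            map_add' := fun f g ↦ by
              simp only [Pi.add_apply, padicPi_add_left, Finset.sum_add_distrib] }, fun f ↦ rfl, ?_⟩
  intro c f
  simp only [AddMonoidHom.coe_mk, ZeroHom.coe_mk, Pi.smul_apply, smul_eq_mul, map_sum, padicPi_padicPi]

/-- **KRULL STEP.** Let `M ⊆ ∏_m H¹(H, E[p^m])` be a subgroup stable under the `ℤ_p`-action, `r : B → ∏ H¹` a
finite family, and `x` an element such that for EVERY `n` one has `x = m_n + Σ_b pⁿ f_{n,b} · r_b` with `m_n ∈ M`.
Then `x ∈ M`: with `Φ f = Σ f_b · r_b` and the `ℤ_p`-submodule `L = Φ⁻¹(M)` of `ℤ_p^B`, the class of `f_0` in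
`ℤ_p^B/L` lies in `pⁿ(ℤ_p^B/L)` for all `n`, hence is `0` by Krull's intersection theorem over the Noetherian local
ring `ℤ_p`. [cite: Washington1997, §13.2 (compact Λ- and ℤ_p-modules; Nakayama/Krull)] -/
theorem mem_of_forall_eq_add_sum_padicPi_pow_mul {B : Type*} [Fintype B]
    (M : AddSubgroup (V.torsionH1Pi p H)) (hM : ∀ (c : ℤ_[p]) {y}, y ∈ M → V.padicPi p H c y ∈ M)
    (r : B → V.torsionH1Pi p H) {x : V.torsionH1Pi p H}
    (hx : ∀ n : ℕ, ∃ m ∈ M, ∃ f : B → ℤ_[p], x = m + ∑ b, V.padicPi p H ((p : ℤ_[p]) ^ n * f b) (r b)) :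
    x ∈ M := by
  obtain ⟨Φ, hΦ, hΦc⟩ := V.exists_addMonoidHom_padicPi_sum p H r
  have hΦn : ∀ (n : ℕ) (f : B → ℤ_[p]),
      ∑ b, V.padicPi p H ((p : ℤ_[p]) ^ n * f b) (r b) = Φ (((p : ℤ_[p]) ^ n) • f) := by
    intro n f
    rw [hΦ]
    rfl
  let L : Submodule ℤ_[p] (B → ℤ_[p]) :=
    { carrier := {f | Φ f ∈ M}
      zero_mem' := by
        show Φ 0 ∈ M
        rw [map_zero]; exact M.zero_mem
      add_mem' := fun {f g} hf hg ↦ by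
        show Φ (f + g) ∈ M
        rw [map_add]; exact M.add_mem hf hg
      smul_mem' := fun c f hf ↦ by
        show Φ (c • f) ∈ M
        rw [hΦc]; exact hM c hf }
  obtain ⟨m₀, hm₀, f₀, hx₀⟩ := hx 0
  rw [hΦn, pow_zero, one_smul] at hx₀
  suffices hL : f₀ ∈ L by rw [hx₀]; exact M.add_mem hm₀ hL
  have hmk : L.mkQ f₀ ∈ (⨅ n : ℕ, (Ideal.span {(p : ℤ_[p])}) ^ n • (⊤ : Submodule ℤ_[p] ((B → ℤ_[p]) ⧸ L))) := by
    rw [Submodule.mem_iInf]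
    intro n
    obtain ⟨m, hm, f, hxn⟩ := hx n
    rw [hΦn] at hxn
    have hdiff : f₀ - ((p : ℤ_[p]) ^ n) • f ∈ L := by
      show Φ (f₀ - ((p : ℤ_[p]) ^ n) • f) ∈ M
      have h : Φ (f₀ - ((p : ℤ_[p]) ^ n) • f) = m - m₀ := by
        rw [map_sub]
        have h1 : Φ f₀ = x - m₀ := by rw [hx₀]; abel
        have h2 : Φ (((p : ℤ_[p]) ^ n) • f) = x - m := by rw [hxn]; abel
        rw [h1, h2]; abel
      rw [h]
      exact M.sub_mem hm hm₀
    have hq : L.mkQ f₀ = ((p : ℤ_[p]) ^ n) • L.mkQ f := by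
      rw [← map_smul, ← sub_eq_zero, ← map_sub, Submodule.mkQ_apply, Submodule.Quotient.mk_eq_zero]
      exact hdiff
    rw [hq]
    exact Submodule.smul_mem_smul (Ideal.pow_mem_pow (Ideal.mem_span_singleton_self _) n) Submodule.mem_top
  have hne : Ideal.span {(p : ℤ_[p])} ≠ ⊤ := by
    rw [Ne, Ideal.span_singleton_eq_top]
    exact PadicInt.irreducible_p.not_isUnit
  rw [Ideal.iInf_pow_smul_eq_bot_of_isLocalRing _ hne, Submodule.mem_bot, Submodule.mkQ_apply,
    Submodule.Quotient.mk_eq_zero] at hmk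
  exact hmk

end Krull

end WeierstrassCurve

/-! ## §2 The abstract transport predicate -/

namespace Literature.NumberTheory.EllipticCurves

section Transport

variable {p : ℕ} [Fact p.Prime] {V₁ V₀ P : Type*} [AddCommGroup V₁] [AddCommGroup V₀] [AddCommGroup P]
  [Module ℤ_[p] P] (𝒩 : V₁ →+ V₁) (res : V₀ →+ V₁) (M : AddSubgroup V₀) (Ψ : P →+ V₀) (q : ℤ_[p])

/-- The transport predicate `∃ m ∈ M, ∃ f, 𝒩 x = res (m + Ψ (q • f))` is closed under the subgroup operations:
if it holds on a set `S` it holds on `AddSubgroup.closure S`. [cite: PerrinRiou1987BSMF, §0 p. 402 (bookkeeping of norm-compatible families)] -/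
theorem exists_norm_eq_res_of_mem_closure {S : Set V₁}
    (hS : ∀ x ∈ S, ∃ m ∈ M, ∃ f : P, 𝒩 x = res (m + Ψ (q • f))) {x : V₁} (hx : x ∈ AddSubgroup.closure S) :
    ∃ m ∈ M, ∃ f : P, 𝒩 x = res (m + Ψ (q • f)) := by
  induction hx using AddSubgroup.closure_induction with
  | mem y hy => exact hS y hy
  | zero => exact ⟨0, M.zero_mem, 0, by rw [map_zero, smul_zero, map_zero, add_zero, map_zero]⟩
  | add a b _ _ ha hb =>
    obtain ⟨m, hm, f, hf⟩ := ha
    obtain ⟨m', hm', f', hf'⟩ := hb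
    refine ⟨m + m', M.add_mem hm hm', f + f', ?_⟩
    simp only [map_add, smul_add, hf, hf']
    abel
  | neg a _ ha =>
    obtain ⟨m, hm, f, hf⟩ := ha
    refine ⟨-m, M.neg_mem hm, -f, ?_⟩
    simp only [map_neg, smul_neg, map_add, hf]
    abel

/-- The transport predicate is preserved by a pair of compatible operators `(θ₁, θ₀)` (`𝒩 θ₁ = θ₁ 𝒩`,
`θ₁ res = res θ₀`, `θ₀ M ⊆ M`, `θ₀ Ψ = Ψ g` with `g` `ℤ_p`-linear) — used for the `ℤ_p`-action and for `conj_{γ^i}`.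
[cite: PerrinRiou1987BSMF, §0 p. 402 (ℤ_p[Gal]-structure of the norm-compatible families)] -/
theorem exists_norm_eq_res_map (θ₁ : V₁ →+ V₁) (θ₀ : V₀ →+ V₀) (g : P →ₗ[ℤ_[p]] P)
    (hN : ∀ x, 𝒩 (θ₁ x) = θ₁ (𝒩 x)) (hres : ∀ y, θ₁ (res y) = res (θ₀ y)) (hM : ∀ m ∈ M, θ₀ m ∈ M)
    (hΨ : ∀ f, θ₀ (Ψ f) = Ψ (g f)) {x : V₁} (hx : ∃ m ∈ M, ∃ f : P, 𝒩 x = res (m + Ψ (q • f))) :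
    ∃ m ∈ M, ∃ f : P, 𝒩 (θ₁ x) = res (m + Ψ (q • f)) := by
  obtain ⟨m, hm, f, hf⟩ := hx
  refine ⟨θ₀ m, hM m hm, g f, ?_⟩
  rw [hN, hf, hres, map_add, hΨ, map_smul]

/-- The transport predicate is preserved by integer multiples. [cite: PerrinRiou1987BSMF, §0 p. 402] -/
theorem exists_norm_eq_res_zsmul (z : ℤ) {x : V₁} (hx : ∃ m ∈ M, ∃ f : P, 𝒩 x = res (m + Ψ (q • f))) :
    ∃ m ∈ M, ∃ f : P, 𝒩 (z • x) = res (m + Ψ (q • f)) := by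
  obtain ⟨m, hm, f, hf⟩ := hx
  refine ⟨z • m, M.zsmul_mem hm z, z • f, ?_⟩
  rw [map_zsmul, hf, ← map_zsmul, zsmul_add, smul_comm q z f, map_zsmul]

/-- The transport predicate is preserved by sums. [cite: PerrinRiou1987BSMF, §0 p. 402] -/
theorem exists_norm_eq_res_add {x y : V₁} (hx : ∃ m ∈ M, ∃ f : P, 𝒩 x = res (m + Ψ (q • f)))
    (hy : ∃ m ∈ M, ∃ f : P, 𝒩 y = res (m + Ψ (q • f))) :
    ∃ m ∈ M, ∃ f : P, 𝒩 (x + y) = res (m + Ψ (q • f)) := by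
  obtain ⟨m, hm, f, hf⟩ := hx
  obtain ⟨m', hm', f', hf'⟩ := hy
  refine ⟨m + m', M.add_mem hm hm', f + f', ?_⟩
  simp only [map_add, smul_add, hf, hf']
  abel

end Transport

end Literature.NumberTheory.EllipticCurves

end
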